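import Mathlib
import Summits.MatrixMultiplication.MatrixMultiplication.Theorems.HiddenToeplitzCornersHiddenCornerLemmaRStein

/-!
# Intersection lemma: `dim(G♯_a ∩ G^{(b)})` is at most the number of short syzygies
# (hidden-corner lemma, crux stmt-MatrixMultiplication-10752)

Support file for crux item `stmt-MatrixMultiplication-10752`
(`Summit.MatrixMultiplication.MatrixMultiplication.Theses.HiddenToeplitzCorners.HiddenCornerLemmaR`),
line `atkinson-lloyd-core-split`, stub `hclR_intersection_le_shortSyzygy` (lemma L2 of the lead's
MONOMIAL THEOREM, `Cruxes/HiddenCornerLemmaR/Lines/atkinson-lloyd-core-split-MONOMIAL_THEOREM.md`).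

Setting: `ℂ^N = ℂ[x]/(x^N)`, `e_n ↔ x^n`; `Z` is the lower shift written verbatim as in the crux
(`Z i j = [i = j + 1]`, multiplication by `x`), `Zᵀ` divides by `x`; `g_k` is column `k` of
`G₀ : N × p`, `L(g_k) = Σ_i G₀ i k • Z^i` multiplies by `g_k`; column `k₀` of `G₀` is `e_0`
(so `L(g_{k₀}) = 1`); `a + b ≤ N`; `𝔄 := span({(Zᵀ)^i g_k : 1 ≤ i ≤ a} ∪ {e_n : n ≥ N - a})`,
`𝔅 := span({e_n : n < b} ∪ {Z^i g_k : i < b})`; a short syzygy is `β : Fin p → ℂ^N` with every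
`β_k` supported in degrees `< a + b` and `Σ_k L(g_k) β_k = 0`.
Statement (`hclR_intersection_le_shortSyzygy`): if any `σ + 1` short syzygies are linearly
dependent, then `finrank (𝔄 ⊓ 𝔅) ≤ σ`.

Proof.  (1) `dim 𝔄 ≤ p·a` (`hclR_il_finrank_A_le`; `(Zᵀ)^i e_0 = 0` for `i ≥ 1`).
(2) `dim 𝔅 ≤ p·b` (`hclR_il_finrank_B_le`; `Z^n e_0 = e_n`).  (3) `p(a+b) ≤ dim(𝔄 ⊔ 𝔅) + σ`
(`hclR_il_finrank_sup`): the frame map `c ↦ Σ c (k,l) • vec (k,l)` on `ℂ^{Fin p × Fin (a+b)}`,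
`vec (k,l) = (Zᵀ)^{a-l} g_k` (`l < a`), `Z^{l-a} g_k` (`l ≥ a`) for `k ≠ k₀` and the monomials
`e_{N-a+l}` (`l < a`), `e_{l-a}` (`l ≥ a`) for `k = k₀` (`hclR_ilVec`, given by its entries), has
range in `𝔄 ⊔ 𝔅` (`hclR_ilVec_mem`) and kernel of dimension `≤ σ`: for `c` in the kernel the tuple
`β_k :=` zero-extension of `c (k,·)` (`k ≠ k₀`), `β_{k₀} := -Σ_{k ≠ k₀} L(g_k) β_k` is a short
syzygy — the KEY COMPUTATION `hclR_il_key` identifies the coefficient of degree `m ≥ a + b` of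
`Σ_{k ≠ k₀} g_k β_k` with row `m - a` of the frame combination — and `c ↦ β` is injective there
(`hclR_il_inj`: rows `< b` and `≥ N - a` read off the block `k₀`), so `σ + 1` independent kernel
vectors would give `σ + 1` independent short syzygies (`hclR_il_dependent`); then rank–nullity.
(4) `dim(𝔄 ⊓ 𝔅) = dim 𝔄 + dim 𝔅 - dim(𝔄 ⊔ 𝔅) ≤ σ` (`Submodule.finrank_sup_add_finrank_inf_eq`).
No edge case (`p = 1`, `a = 0`, `b = 0`) needs separate treatment.  Folklore linear algebra.
-/

set_option linter.dupNamespace false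

namespace Summit.MatrixMultiplication.MatrixMultiplication.Theorems

open Matrix BigOperators Finset

/-- The lower-triangular Toeplitz operator `L(g_k) = Σ_i G₀ i k • Z^i` applied to a vector:
`(L(g_k) v)_m = Σ_{j ≤ m} G₀ (m - j) k · v j`. -/
theorem hclR_il_L_mulVec {N p : ℕ} (G₀ : Matrix (Fin N) (Fin p) ℂ) (k : Fin p) (v : Fin N → ℂ)
    (m : Fin N) :
    ((∑ i : Fin N, G₀ i k • (Matrix.of fun i j : Fin N => if (i : ℕ) = (j : ℕ) + 1 then (1 : ℂ) else 0) ^ (i : ℕ)) *ᵥ v) m =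
      ∑ j : Fin N, (if h : (j : ℕ) ≤ (m : ℕ) then G₀ ⟨(m : ℕ) - (j : ℕ), by omega⟩ k else 0) * v j := by
  rw [Matrix.mulVec, dotProduct]
  refine Finset.sum_congr rfl fun j _ => ?_
  congr 1
  rw [Matrix.sum_apply]
  simp only [Matrix.smul_apply, hclR_shift_pow_apply, smul_eq_mul, mul_ite, mul_one, mul_zero]
  by_cases h : (j : ℕ) ≤ (m : ℕ)
  · rw [dif_pos h, Finset.sum_eq_single ⟨(m : ℕ) - (j : ℕ), by omega⟩]
    · simp; omega
    · intro i _ hi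
      have : ¬ ((m : ℕ) = (j : ℕ) + (i : ℕ)) := fun h' => hi (Fin.ext (by simp; omega))
      simp [this]
    · simp
  · rw [dif_neg h]
    refine Finset.sum_eq_zero fun i _ => ?_
    have : ¬ ((m : ℕ) = (j : ℕ) + (i : ℕ)) := by omega
    simp [this]

/-- For the constant column `g_{k₀} = e_0`, `L(g_{k₀})` acts as the identity. -/
theorem hclR_il_L_col0_mulVec {N p : ℕ} (G₀ : Matrix (Fin N) (Fin p) ℂ) (k₀ : Fin p)
    (hk₀ : ∀ n : Fin N, G₀ n k₀ = if (n : ℕ) = 0 then 1 else 0) (v : Fin N → ℂ) :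
    (∑ i : Fin N, G₀ i k₀ • (Matrix.of fun i j : Fin N => if (i : ℕ) = (j : ℕ) + 1 then (1 : ℂ) else 0) ^ (i : ℕ)) *ᵥ v = v := by
  funext m
  rw [hclR_il_L_mulVec, Finset.sum_eq_single m]
  · simp [hk₀]
  · intro j _ hj
    by_cases h : (j : ℕ) ≤ (m : ℕ)
    · rw [dif_pos h, hk₀]
      have : ¬ ((m : ℕ) - (j : ℕ) = 0) := fun h' => hj (Fin.ext (by omega))
      simp [this]
    · rw [dif_neg h, zero_mul]
  · simp

/-- `Z^n e_0 = e_n`: the down-shifts of the constant column are the monomials. -/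
theorem hclR_il_shift_pow_col0 {N p : ℕ} (G₀ : Matrix (Fin N) (Fin p) ℂ) (k₀ : Fin p)
    (hk₀ : ∀ n : Fin N, G₀ n k₀ = if (n : ℕ) = 0 then 1 else 0) (n : Fin N) :
    (Matrix.of fun i j : Fin N => if (i : ℕ) = (j : ℕ) + 1 then (1 : ℂ) else 0) ^ (n : ℕ) *ᵥ (fun m => G₀ m k₀) = Pi.single n 1 := by
  funext m
  rw [hclR_shift_pow_mulVec, Pi.single_apply]
  by_cases h : (n : ℕ) ≤ (m : ℕ)
  · rw [dif_pos h, hk₀]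
    have : ((m : ℕ) - n = 0) ↔ m = n := by rw [Fin.ext_iff]; omega
    simp only [this]
  · rw [dif_neg h, if_neg (by rintro rfl; omega)]

/-- `(Zᵀ)^i e_0 = 0` for `i ≥ 1`: the up-shifts of the constant column vanish. -/
theorem hclR_il_shiftT_pow_col0 {N p : ℕ} (G₀ : Matrix (Fin N) (Fin p) ℂ) (k₀ : Fin p)
    (hk₀ : ∀ n : Fin N, G₀ n k₀ = if (n : ℕ) = 0 then 1 else 0) (i : ℕ) (hi : 1 ≤ i) :
    (Matrix.of fun i j : Fin N => if (i : ℕ) = (j : ℕ) + 1 then (1 : ℂ) else 0)ᵀ ^ i *ᵥ (fun m => G₀ m k₀) = 0 := by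
  funext m
  rw [hclR_shiftT_pow_mulVec, Pi.zero_apply]
  by_cases h : (m : ℕ) + i < N
  · have : ¬ ((m : ℕ) + i = 0) := by omega
    rw [dif_pos h, hk₀, if_neg this]
  · rw [dif_neg h]

/-- Reindexing: a sum over `Fin N` against the zero-extension of `ψ : Fin M → ℂ` (`M ≤ N`) is the
corresponding sum over `Fin M`. -/
theorem hclR_il_sum_ext {N M : ℕ} (hM : M ≤ N) (φ : Fin N → ℂ) (ψ : Fin M → ℂ) :
    ∑ j : Fin N, φ j * (if h : (j : ℕ) < M then ψ ⟨j, h⟩ else 0) =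
      ∑ l : Fin M, φ (Fin.castLE hM l) * ψ l := by
  symm
  apply Fintype.sum_of_injective (Fin.castLE hM) (Fin.castLE_injective hM)
  · intro j hj
    have : ¬ ((j : ℕ) < M) := fun h => hj ⟨⟨j, h⟩, Fin.ext rfl⟩
    rw [dif_neg this, mul_zero]
  · intro l
    rw [dif_pos (by simp)]
    rfl

/-- **Step 1.** `dim 𝔄 ≤ p·a`: since `(Zᵀ)^i g_{k₀} = 0` for `i ≥ 1`, the space `𝔄` is spanned
by a family indexed by `Fin p × Fin a` (the slot `k₀` carries the monomials `e_n`, `n ≥ N - a`). -/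
theorem hclR_il_finrank_A_le (N p a : ℕ) (G₀ : Matrix (Fin N) (Fin p) ℂ) (k₀ : Fin p)
    (hk₀ : ∀ n : Fin N, G₀ n k₀ = if (n : ℕ) = 0 then 1 else 0) (haN : a ≤ N) :
    Module.finrank ℂ ↥(Submodule.span ℂ ({w : Fin N → ℂ | ∃ (k : Fin p) (i : ℕ), 1 ≤ i ∧ i ≤ a ∧ w = (Matrix.of fun i j : Fin N => if (i : ℕ) = (j : ℕ) + 1 then (1 : ℂ) else 0)ᵀ ^ i *ᵥ (fun n => G₀ n k)} ∪ {w : Fin N → ℂ | ∃ n : Fin N, N ≤ (n : ℕ) + a ∧ w = Pi.single n 1})) ≤ p * a := by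
  let f : Fin p × Fin a → (Fin N → ℂ) := fun ki =>
    if ki.1 = k₀ then Pi.single (⟨N - a + ki.2, by omega⟩ : Fin N) 1
    else (Matrix.of fun i j : Fin N => if (i : ℕ) = (j : ℕ) + 1 then (1 : ℂ) else 0)ᵀ ^ ((ki.2 : ℕ) + 1) *ᵥ fun n => G₀ n ki.1
  have hle : Submodule.span ℂ ({w : Fin N → ℂ | ∃ (k : Fin p) (i : ℕ), 1 ≤ i ∧ i ≤ a ∧ w = (Matrix.of fun i j : Fin N => if (i : ℕ) = (j : ℕ) + 1 then (1 : ℂ) else 0)ᵀ ^ i *ᵥ (fun n => G₀ n k)} ∪ {w : Fin N → ℂ | ∃ n : Fin N, N ≤ (n : ℕ) + a ∧ w = Pi.single n 1}) ≤ Submodule.span ℂ (Set.range f) := by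
    rw [Submodule.span_le]
    rintro w (⟨k, i, h1, h2, rfl⟩ | ⟨n, hn, rfl⟩)
    · by_cases hk : k = k₀
      · rw [hk, hclR_il_shiftT_pow_col0 G₀ k₀ hk₀ i h1]
        exact zero_mem _
      · refine Submodule.subset_span ⟨(k, ⟨i - 1, by omega⟩), ?_⟩
        simp only [f, if_neg hk, Nat.sub_add_cancel h1]
    · refine Submodule.subset_span ⟨(k₀, ⟨n - (N - a), by omega⟩), ?_⟩
      simp only [f, if_pos rfl]
      congr 1
      exact Fin.ext (by simp; omega)
  calc _ ≤ Module.finrank ℂ ↥(Submodule.span ℂ (Set.range f)) := Submodule.finrank_mono hle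
    _ ≤ Fintype.card (Fin p × Fin a) := finrank_range_le_card f
    _ = p * a := by rw [Fintype.card_prod, Fintype.card_fin, Fintype.card_fin]

/-- **Step 2.** `dim 𝔅 ≤ p·b`: since `Z^n g_{k₀} = e_n`, the monomials `e_n` (`n < b`) are among
the shifts of the constant column, so `𝔅` is spanned by `{Z^i g_k : i < b, k}`. -/
theorem hclR_il_finrank_B_le (N p b : ℕ) (G₀ : Matrix (Fin N) (Fin p) ℂ) (k₀ : Fin p)
    (hk₀ : ∀ n : Fin N, G₀ n k₀ = if (n : ℕ) = 0 then 1 else 0) :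
    Module.finrank ℂ ↥(Submodule.span ℂ ({w : Fin N → ℂ | ∃ n : Fin N, (n : ℕ) < b ∧ w = Pi.single n 1} ∪ {w : Fin N → ℂ | ∃ (k : Fin p) (i : ℕ), i < b ∧ w = (Matrix.of fun i j : Fin N => if (i : ℕ) = (j : ℕ) + 1 then (1 : ℂ) else 0) ^ i *ᵥ (fun n => G₀ n k)})) ≤ p * b := by
  let f : Fin p × Fin b → (Fin N → ℂ) := fun ki => (Matrix.of fun i j : Fin N => if (i : ℕ) = (j : ℕ) + 1 then (1 : ℂ) else 0) ^ (ki.2 : ℕ) *ᵥ fun n => G₀ n ki.1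
  have hle : Submodule.span ℂ ({w : Fin N → ℂ | ∃ n : Fin N, (n : ℕ) < b ∧ w = Pi.single n 1} ∪ {w : Fin N → ℂ | ∃ (k : Fin p) (i : ℕ), i < b ∧ w = (Matrix.of fun i j : Fin N => if (i : ℕ) = (j : ℕ) + 1 then (1 : ℂ) else 0) ^ i *ᵥ (fun n => G₀ n k)}) ≤ Submodule.span ℂ (Set.range f) := by
    rw [Submodule.span_le]
    rintro w (⟨n, hn, rfl⟩ | ⟨k, i, hi, rfl⟩)
    · exact Submodule.subset_span ⟨(k₀, ⟨n, hn⟩), hclR_il_shift_pow_col0 G₀ k₀ hk₀ n⟩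
    · exact Submodule.subset_span ⟨(k, ⟨i, hi⟩), rfl⟩
  calc _ ≤ Module.finrank ℂ ↥(Submodule.span ℂ (Set.range f)) := Submodule.finrank_mono hle
    _ ≤ Fintype.card (Fin p × Fin b) := finrank_range_le_card f
    _ = p * b := by rw [Fintype.card_prod, Fintype.card_fin, Fintype.card_fin]

/-- Entries of the frame `vec` feeding the rank count of `𝔄 ⊔ 𝔅` (indexed by
`Fin p × Fin (a + b)`; for `k ≠ k₀` the slot `(k, l)` is `(Zᵀ)^(a-l) g_k` (`l < a`) resp.
`Z^(l-a) g_k` (`l ≥ a`), i.e. `n ↦ G₀ (n + a - l) k`; the slot `(k₀, l)` is the monomial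
`e_{N-a+l}` (`l < a`) resp. `e_{l-a}` (`l ≥ a`)): the slots `k ≠ k₀` inside the band. -/
theorem hclR_ilVec_ne {N p a b : ℕ} (G₀ : Matrix (Fin N) (Fin p) ℂ) (k₀ : Fin p)
    (vec : Fin p × Fin (a + b) → Fin N → ℂ) (hvec : ∀ (kl : Fin p × Fin (a + b)) (n : Fin N),
      vec kl n = if kl.1 = k₀ then (if (n : ℕ) + a = kl.2 ∨ (n : ℕ) + a = N + kl.2 then 1 else 0) else
        if h : (kl.2 : ℕ) ≤ (n : ℕ) + a ∧ (n : ℕ) + a - kl.2 < N then G₀ ⟨(n : ℕ) + a - kl.2, h.2⟩ kl.1 else 0)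
    {kl : Fin p × Fin (a + b)} (hk : kl.1 ≠ k₀) (n i : Fin N)
    (hi : (kl.2 : ℕ) + (i : ℕ) = (n : ℕ) + a) : vec kl n = G₀ i kl.1 := by
  have h : (kl.2 : ℕ) ≤ (n : ℕ) + a ∧ (n : ℕ) + a - kl.2 < N := ⟨by omega, by omega⟩
  have hi' : (⟨(n : ℕ) + a - kl.2, h.2⟩ : Fin N) = i := Fin.ext (by dsimp only; omega)
  rw [hvec, if_neg hk, dif_pos h, hi']

/-- Entries of the frame: the slots `k ≠ k₀` vanish outside the band. -/
theorem hclR_ilVec_ne_zero {N p a b : ℕ} (G₀ : Matrix (Fin N) (Fin p) ℂ) (k₀ : Fin p)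
    (vec : Fin p × Fin (a + b) → Fin N → ℂ) (hvec : ∀ (kl : Fin p × Fin (a + b)) (n : Fin N),
      vec kl n = if kl.1 = k₀ then (if (n : ℕ) + a = kl.2 ∨ (n : ℕ) + a = N + kl.2 then 1 else 0) else
        if h : (kl.2 : ℕ) ≤ (n : ℕ) + a ∧ (n : ℕ) + a - kl.2 < N then G₀ ⟨(n : ℕ) + a - kl.2, h.2⟩ kl.1 else 0)
    {kl : Fin p × Fin (a + b)} (hk : kl.1 ≠ k₀) (n : Fin N)
    (hn : N + (kl.2 : ℕ) ≤ (n : ℕ) + a ∨ (n : ℕ) + a < kl.2) : vec kl n = 0 := by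
  have h : ¬ ((kl.2 : ℕ) ≤ (n : ℕ) + a ∧ (n : ℕ) + a - kl.2 < N) := by omega
  rw [hvec, if_neg hk, dif_neg h]

/-- Every frame vector lies in `𝔄 ⊔ 𝔅`. -/
theorem hclR_ilVec_mem (N p a b : ℕ) (G₀ : Matrix (Fin N) (Fin p) ℂ) (k₀ : Fin p)
    (vec : Fin p × Fin (a + b) → Fin N → ℂ) (hvec : ∀ (kl : Fin p × Fin (a + b)) (n : Fin N),
      vec kl n = if kl.1 = k₀ then (if (n : ℕ) + a = kl.2 ∨ (n : ℕ) + a = N + kl.2 then 1 else 0) else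
        if h : (kl.2 : ℕ) ≤ (n : ℕ) + a ∧ (n : ℕ) + a - kl.2 < N then G₀ ⟨(n : ℕ) + a - kl.2, h.2⟩ kl.1 else 0)
    (hab : a + b ≤ N) (kl : Fin p × Fin (a + b)) :
    vec kl ∈ Submodule.span ℂ ({w : Fin N → ℂ | ∃ (k : Fin p) (i : ℕ), 1 ≤ i ∧ i ≤ a ∧ w = (Matrix.of fun i j : Fin N => if (i : ℕ) = (j : ℕ) + 1 then (1 : ℂ) else 0)ᵀ ^ i *ᵥ (fun n => G₀ n k)} ∪ {w : Fin N → ℂ | ∃ n : Fin N, N ≤ (n : ℕ) + a ∧ w = Pi.single n 1}) ⊔ Submodule.span ℂ ({w : Fin N → ℂ | ∃ n : Fin N, (n : ℕ) < b ∧ w = Pi.single n 1} ∪ {w : Fin N → ℂ | ∃ (k : Fin p) (i : ℕ), i < b ∧ w = (Matrix.of fun i j : Fin N => if (i : ℕ) = (j : ℕ) + 1 then (1 : ℂ) else 0) ^ i *ᵥ (fun n => G₀ n k)}) := by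
  obtain ⟨k, l⟩ := kl
  by_cases hk : k = k₀
  · rw [hk]
    by_cases hl : a ≤ (l : ℕ)
    · -- the monomial `e_{l-a}`, `l - a < b`
      refine Submodule.mem_sup_right (Submodule.subset_span (Or.inl ⟨⟨(l : ℕ) - a, by omega⟩,
        by dsimp only; omega, ?_⟩))
      funext n
      rw [hvec, if_pos rfl, Pi.single_apply]
      exact if_congr (by rw [Fin.ext_iff]; dsimp only; omega) rfl rfl
    · -- the monomial `e_{N-a+l}`
      refine Submodule.mem_sup_left (Submodule.subset_span (Or.inr ⟨⟨N - a + (l : ℕ), by omega⟩,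
        by dsimp only; omega, ?_⟩))
      funext n
      rw [hvec, if_pos rfl, Pi.single_apply]
      exact if_congr (by rw [Fin.ext_iff]; dsimp only; omega) rfl rfl
  · by_cases hl : a ≤ (l : ℕ)
    · -- `Z^(l-a) g_k`, `l - a < b`
      refine Submodule.mem_sup_right (Submodule.subset_span (Or.inr ⟨k, (l : ℕ) - a, by omega, ?_⟩))
      funext n
      rw [hclR_shift_pow_mulVec]
      by_cases h : (l : ℕ) - a ≤ (n : ℕ)
      · rw [dif_pos h]
        exact hclR_ilVec_ne G₀ k₀ vec hvec hk n _ (by dsimp only; omega)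
      · rw [dif_neg h]
        exact hclR_ilVec_ne_zero G₀ k₀ vec hvec hk n (by simp only; omega)
    · -- `(Zᵀ)^(a-l) g_k`, `1 ≤ a - l ≤ a`
      refine Submodule.mem_sup_left (Submodule.subset_span (Or.inl ⟨k, a - (l : ℕ), by omega,
        by omega, ?_⟩))
      funext n
      rw [hclR_shiftT_pow_mulVec]
      by_cases h : (n : ℕ) + (a - (l : ℕ)) < N
      · rw [dif_pos h]
        exact hclR_ilVec_ne G₀ k₀ vec hvec hk n _ (by dsimp only; omega)
      · rw [dif_neg h]
        exact hclR_ilVec_ne_zero G₀ k₀ vec hvec hk n (by simp only; omega)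

/-- **Key computation.** In a row `m ≥ a + b` the coefficient of degree `m` of `Σ_{k ≠ k₀} g_k β_k`
(`β_k = ext c k` the zero-extension of the block `c (k, ·)`) is row `m - a` of the frame
combination `Σ_{kl} c kl • vec kl` (a middle row, where the `k₀`-slots vanish). -/
theorem hclR_il_key (N p a b : ℕ) (G₀ : Matrix (Fin N) (Fin p) ℂ) (k₀ : Fin p)
    (vec : Fin p × Fin (a + b) → Fin N → ℂ) (hvec : ∀ (kl : Fin p × Fin (a + b)) (n : Fin N),
      vec kl n = if kl.1 = k₀ then (if (n : ℕ) + a = kl.2 ∨ (n : ℕ) + a = N + kl.2 then 1 else 0) else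
        if h : (kl.2 : ℕ) ≤ (n : ℕ) + a ∧ (n : ℕ) + a - kl.2 < N then G₀ ⟨(n : ℕ) + a - kl.2, h.2⟩ kl.1 else 0)
    (ext : (Fin p × Fin (a + b) → ℂ) → Fin p → Fin N → ℂ)
    (hext : ∀ (c : Fin p × Fin (a + b) → ℂ) (k : Fin p) (j : Fin N),
      ext c k j = if h : (j : ℕ) < a + b then c (k, ⟨j, h⟩) else 0)
    (hab : a + b ≤ N) (c : Fin p × Fin (a + b) → ℂ) (m : Fin N) (hm : a + b ≤ (m : ℕ)) :
    (∑ k ∈ Finset.univ.erase k₀, (∑ i : Fin N, G₀ i k • (Matrix.of fun i j : Fin N => if (i : ℕ) = (j : ℕ) + 1 then (1 : ℂ) else 0) ^ (i : ℕ)) *ᵥ ext c k) m =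
      ∑ kl : Fin p × Fin (a + b), c kl * vec kl ⟨(m : ℕ) - a, by omega⟩ := by
  rw [Finset.sum_apply, Fintype.sum_prod_type, ← Finset.add_sum_erase _ _ (Finset.mem_univ k₀)]
  -- the `k₀`-block of the right-hand side vanishes in these rows
  have h0 : ∑ l : Fin (a + b), c (k₀, l) * vec (k₀, l) ⟨(m : ℕ) - a, by omega⟩ = 0 := by
    refine Finset.sum_eq_zero fun l _ => ?_
    have : ¬ (((m : ℕ) - a + a = (l : ℕ)) ∨ ((m : ℕ) - a + a = N + (l : ℕ))) := by
      have := l.2; have := m.2; omega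
    rw [hvec, if_pos rfl, if_neg this, mul_zero]
  rw [h0, zero_add]
  refine Finset.sum_congr rfl fun k hk => ?_
  have hk' : k ≠ k₀ := Finset.ne_of_mem_erase hk
  rw [hclR_il_L_mulVec]
  simp only [hext]
  rw [hclR_il_sum_ext hab _ (fun l => c (k, l))]
  refine Finset.sum_congr rfl fun l _ => ?_
  rw [dif_pos (show ((Fin.castLE hab l : Fin N) : ℕ) ≤ (m : ℕ) by simp only [Fin.val_castLE]; omega),
    mul_comm]
  exact congrArg (c (k, l) * ·)
    (hclR_ilVec_ne G₀ k₀ vec hvec (kl := (k, l)) hk' _ _ (by simp only [Fin.val_castLE]; omega)).symm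

/-- **Injectivity.** A coefficient vector whose blocks `k ≠ k₀` vanish and whose frame combination
vanishes is zero: the rows `< b` and `≥ N - a` of the combination read off the block `k₀`. -/
theorem hclR_il_inj {N p a b : ℕ} (G₀ : Matrix (Fin N) (Fin p) ℂ) (k₀ : Fin p)
    (vec : Fin p × Fin (a + b) → Fin N → ℂ) (hvec : ∀ (kl : Fin p × Fin (a + b)) (n : Fin N),
      vec kl n = if kl.1 = k₀ then (if (n : ℕ) + a = kl.2 ∨ (n : ℕ) + a = N + kl.2 then 1 else 0) else
        if h : (kl.2 : ℕ) ≤ (n : ℕ) + a ∧ (n : ℕ) + a - kl.2 < N then G₀ ⟨(n : ℕ) + a - kl.2, h.2⟩ kl.1 else 0)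
    (hab : a + b ≤ N) (s : Fin p × Fin (a + b) → ℂ) (hoff : ∀ k, k ≠ k₀ → ∀ l, s (k, l) = 0)
    (hΦ : ∀ n : Fin N, ∑ kl : Fin p × Fin (a + b), s kl * vec kl n = 0) : s = 0 := by
  funext ⟨k, l⟩
  by_cases hk : k = k₀
  · rw [hk]
    obtain ⟨n, hn⟩ : ∃ n : Fin N, ∀ l' : Fin (a + b),
        (((n : ℕ) + a = l' ∨ (n : ℕ) + a = N + l') ↔ l' = l) := by
      by_cases hl : a ≤ (l : ℕ)
      · exact ⟨⟨l - a, by omega⟩, fun l' => by rw [Fin.ext_iff]; dsimp only; omega⟩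
      · exact ⟨⟨N - a + l, by omega⟩, fun l' => by rw [Fin.ext_iff]; dsimp only; omega⟩
    have h1 : ∑ kl : Fin p × Fin (a + b), s kl * vec kl n = s (k₀, l) := by
      rw [Fintype.sum_prod_type, Finset.sum_eq_single_of_mem k₀ (Finset.mem_univ _) ?_]
      · rw [Finset.sum_eq_single_of_mem l (Finset.mem_univ _) ?_]
        · rw [hvec, if_pos rfl, if_pos ((hn l).2 rfl), mul_one]
        · intro l' _ hl'
          rw [hvec, if_pos rfl, if_neg (fun h' => hl' ((hn l').1 h')), mul_zero]
      · intro k' _ hk'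
        exact Finset.sum_eq_zero fun l' _ => by rw [hoff k' hk' l', zero_mul]
    rw [← h1]
    exact hΦ n
  · exact hoff k hk l

/-- **Kernel vectors give dependent short syzygies.**  If `σ + 1` coefficient vectors `c t` all
have vanishing frame combination `Σ_{kl} c t kl • vec kl = 0`, then the associated tuples `β t`
(`β t k` the zero-extension of the block `c t (k, ·)` for `k ≠ k₀`,
`β t k₀ := -Σ_{k ≠ k₀} L(g_k) (β t k)`) are short syzygies (`hclR_il_key`, `L(g_{k₀}) = 1`), hence
dependent by hypothesis, and so are the `c t` (`c ↦ β` is injective there, `hclR_il_inj`). -/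
theorem hclR_il_dependent (N p a b σ : ℕ) (G₀ : Matrix (Fin N) (Fin p) ℂ) (k₀ : Fin p)
    (hk₀ : ∀ n : Fin N, G₀ n k₀ = if (n : ℕ) = 0 then 1 else 0) (hab : a + b ≤ N)
    (hσ : ∀ β : Fin (σ + 1) → (Fin p → (Fin N → ℂ)),
      (∀ (t : Fin (σ + 1)) (k : Fin p) (n : Fin N), a + b ≤ (n : ℕ) → β t k n = 0) →
      (∀ t : Fin (σ + 1), (∑ k : Fin p, (∑ i : Fin N, G₀ i k • (Matrix.of fun i j : Fin N => if (i : ℕ) = (j : ℕ) + 1 then (1 : ℂ) else 0) ^ (i : ℕ)) *ᵥ β t k) = 0) → ¬ LinearIndependent ℂ β)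
    (vec : Fin p × Fin (a + b) → Fin N → ℂ) (hvec : ∀ (kl : Fin p × Fin (a + b)) (n : Fin N),
      vec kl n = if kl.1 = k₀ then (if (n : ℕ) + a = kl.2 ∨ (n : ℕ) + a = N + kl.2 then 1 else 0) else
        if h : (kl.2 : ℕ) ≤ (n : ℕ) + a ∧ (n : ℕ) + a - kl.2 < N then G₀ ⟨(n : ℕ) + a - kl.2, h.2⟩ kl.1 else 0)
    (c : Fin (σ + 1) → (Fin p × Fin (a + b) → ℂ))
    (hrow : ∀ (t : Fin (σ + 1)) (n : Fin N), ∑ kl : Fin p × Fin (a + b), c t kl * vec kl n = 0) :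
    ¬ LinearIndependent ℂ c := by
  intro hc
  -- zero-extension of the blocks, and the associated short syzygies
  obtain ⟨ext, hext⟩ : ∃ ext : (Fin p × Fin (a + b) → ℂ) → Fin p → Fin N → ℂ,
      ∀ c k j, ext c k j = if h : (j : ℕ) < a + b then c (k, ⟨j, h⟩) else 0 := ⟨_, fun _ _ _ => rfl⟩
  set β : Fin (σ + 1) → Fin p → (Fin N → ℂ) := fun t k =>
    if k = k₀ then -(∑ k' ∈ Finset.univ.erase k₀, (∑ i : Fin N, G₀ i k' • (Matrix.of fun i j : Fin N => if (i : ℕ) = (j : ℕ) + 1 then (1 : ℂ) else 0) ^ (i : ℕ)) *ᵥ ext (c t) k') else ext (c t) k with hβ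
  refine hσ β ?_ ?_ ?_
  · -- support in degrees `< a + b`
    intro t k n hn
    by_cases hk : k = k₀
    · simp only [hβ, if_pos hk, Pi.neg_apply]
      rw [hclR_il_key N p a b G₀ k₀ vec hvec ext hext hab (c t) n hn, hrow, neg_zero]
    · simp only [hβ, if_neg hk, hext]
      rw [dif_neg (by omega)]
  · -- syzygy: `L(g_{k₀}) = 1`
    intro t
    rw [← Finset.add_sum_erase _ _ (Finset.mem_univ k₀)]
    have h1 : ∀ k ∈ Finset.univ.erase k₀, (∑ i : Fin N, G₀ i k • (Matrix.of fun i j : Fin N => if (i : ℕ) = (j : ℕ) + 1 then (1 : ℂ) else 0) ^ (i : ℕ)) *ᵥ β t k = (∑ i : Fin N, G₀ i k • (Matrix.of fun i j : Fin N => if (i : ℕ) = (j : ℕ) + 1 then (1 : ℂ) else 0) ^ (i : ℕ)) *ᵥ ext (c t) k := by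
      intro k hk
      simp only [hβ, if_neg (Finset.ne_of_mem_erase hk)]
    have h0 : β t k₀ = -(∑ k' ∈ Finset.univ.erase k₀, (∑ i : Fin N, G₀ i k' • (Matrix.of fun i j : Fin N => if (i : ℕ) = (j : ℕ) + 1 then (1 : ℂ) else 0) ^ (i : ℕ)) *ᵥ ext (c t) k') := if_pos rfl
    rw [Finset.sum_congr rfl h1, h0, Matrix.mulVec_neg, hclR_il_L_col0_mulVec G₀ k₀ hk₀,
      neg_add_cancel]
  · -- linear independence of `β` from that of `c`
    rw [Fintype.linearIndependent_iff]
    intro μ hμ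
    apply Fintype.linearIndependent_iff.mp hc μ
    apply hclR_il_inj G₀ k₀ vec hvec hab
    · intro k hk l
      have h := congr_fun (congr_fun hμ k) (Fin.castLE hab l)
      simp only [Finset.sum_apply, Pi.smul_apply, smul_eq_mul, Pi.zero_apply, hβ, if_neg hk, hext,
        Fin.val_castLE, Fin.is_lt, dif_pos, Fin.eta] at h
      simpa only [Finset.sum_apply, Pi.smul_apply, smul_eq_mul] using h
    · intro n
      simp only [Finset.sum_apply, Pi.smul_apply, smul_eq_mul, Finset.sum_mul]
      rw [Finset.sum_comm]
      refine Finset.sum_eq_zero fun t _ => ?_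
      simp only [mul_assoc, ← Finset.mul_sum, hrow, mul_zero]

/-- **Step 3.** `p·(a+b) ≤ dim(𝔄 ⊔ 𝔅) + σ`: the frame map `c ↦ Σ_{kl} c kl • vec kl` on
`ℂ^{Fin p × Fin (a+b)}` has range in `𝔄 ⊔ 𝔅` (`hclR_ilVec_mem`) and kernel of dimension `≤ σ`
(`hclR_il_dependent`); conclude by rank–nullity. -/
theorem hclR_il_finrank_sup (N p a b σ : ℕ) (G₀ : Matrix (Fin N) (Fin p) ℂ) (k₀ : Fin p)
    (hk₀ : ∀ n : Fin N, G₀ n k₀ = if (n : ℕ) = 0 then 1 else 0) (hab : a + b ≤ N)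
    (hσ : ∀ β : Fin (σ + 1) → (Fin p → (Fin N → ℂ)),
      (∀ (t : Fin (σ + 1)) (k : Fin p) (n : Fin N), a + b ≤ (n : ℕ) → β t k n = 0) →
      (∀ t : Fin (σ + 1), (∑ k : Fin p, (∑ i : Fin N, G₀ i k • (Matrix.of fun i j : Fin N => if (i : ℕ) = (j : ℕ) + 1 then (1 : ℂ) else 0) ^ (i : ℕ)) *ᵥ β t k) = 0) → ¬ LinearIndependent ℂ β) :
    p * a + p * b ≤ Module.finrank ℂ ↥(Submodule.span ℂ ({w : Fin N → ℂ | ∃ (k : Fin p) (i : ℕ), 1 ≤ i ∧ i ≤ a ∧ w = (Matrix.of fun i j : Fin N => if (i : ℕ) = (j : ℕ) + 1 then (1 : ℂ) else 0)ᵀ ^ i *ᵥ (fun n => G₀ n k)} ∪ {w : Fin N → ℂ | ∃ n : Fin N, N ≤ (n : ℕ) + a ∧ w = Pi.single n 1}) ⊔ Submodule.span ℂ ({w : Fin N → ℂ | ∃ n : Fin N, (n : ℕ) < b ∧ w = Pi.single n 1} ∪ {w : Fin N → ℂ | ∃ (k : Fin p) (i : ℕ), i < b ∧ w = (Matrix.of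 fun i j : Fin N => if (i : ℕ) = (j : ℕ) + 1 then (1 : ℂ) else 0) ^ i *ᵥ (fun n => G₀ n k)})) + σ := by
  -- the frame (see `hclR_ilVec_ne`)
  obtain ⟨vec, hvec⟩ : ∃ vec : Fin p × Fin (a + b) → Fin N → ℂ, ∀ kl n,
      vec kl n = if kl.1 = k₀ then (if (n : ℕ) + a = kl.2 ∨ (n : ℕ) + a = N + kl.2 then 1 else 0) else
        if h : (kl.2 : ℕ) ≤ (n : ℕ) + a ∧ (n : ℕ) + a - kl.2 < N then G₀ ⟨(n : ℕ) + a - kl.2, h.2⟩ kl.1 else 0 :=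
    ⟨_, fun _ _ => rfl⟩
  -- (1) the range of the frame map lies in `𝔄 ⊔ 𝔅`
  have hrange : LinearMap.range (Fintype.linearCombination ℂ vec) ≤
      Submodule.span ℂ ({w : Fin N → ℂ | ∃ (k : Fin p) (i : ℕ), 1 ≤ i ∧ i ≤ a ∧ w = (Matrix.of fun i j : Fin N => if (i : ℕ) = (j : ℕ) + 1 then (1 : ℂ) else 0)ᵀ ^ i *ᵥ (fun n => G₀ n k)} ∪ {w : Fin N → ℂ | ∃ n : Fin N, N ≤ (n : ℕ) + a ∧ w = Pi.single n 1}) ⊔ Submodule.span ℂ ({w : Fin N → ℂ | ∃ n : Fin N, (n : ℕ) < b ∧ w = Pi.single n 1} ∪ {w : Fin N → ℂ | ∃ (k : Fin p) (i : ℕ), i < b ∧ w = (Matrix.of fun i j : Fin N => if (i : ℕ) = (j : ℕ) + 1 then (1 : ℂ) else 0) ^ i *ᵥ (fun n => G₀ n k)}) := by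
    rw [Fintype.range_linearCombination, Submodule.span_le]
    rintro _ ⟨kl, rfl⟩
    exact hclR_ilVec_mem N p a b G₀ k₀ vec hvec hab kl
  -- (2) `dim ker ≤ σ`
  have hker : Module.finrank ℂ ↥(LinearMap.ker (Fintype.linearCombination ℂ vec)) ≤ σ := by
    by_contra hlt
    rw [not_le] at hlt
    -- `σ + 1` independent kernel vectors
    set K := LinearMap.ker (Fintype.linearCombination ℂ vec) with hK
    let bK := Module.finBasis ℂ ↥K
    have hc : LinearIndependent ℂ
        (fun t => ((bK (Fin.castLE hlt t) : ↥K) : Fin p × Fin (a + b) → ℂ)) :=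
      (bK.linearIndependent.comp _ (Fin.castLE_injective hlt)).map' K.subtype
        (Submodule.ker_subtype K)
    refine hclR_il_dependent N p a b σ G₀ k₀ hk₀ hab hσ vec hvec _ (fun t n => ?_) hc
    have h := congr_fun (LinearMap.mem_ker.mp (bK (Fin.castLE hlt t)).2) n
    rw [Fintype.linearCombination_apply, Finset.sum_apply] at h
    simpa only [Pi.smul_apply, smul_eq_mul, Pi.zero_apply] using h
  -- (3) rank–nullity
  have h1 := LinearMap.finrank_range_add_finrank_ker (Fintype.linearCombination ℂ vec)
  have h2 : Module.finrank ℂ (Fin p × Fin (a + b) → ℂ) = p * a + p * b := by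
    rw [Module.finrank_fintype_fun_eq_card, Fintype.card_prod, Fintype.card_fin, Fintype.card_fin,
      mul_add]
  have h3 := Submodule.finrank_mono hrange
  omega

/-- **Intersection lemma (L2 of the monomial theorem).**  `Z` is the lower shift written verbatim
(`ℂ^N = ℂ[x]/(x^N)`, `Z` = multiplication by `x`, `Zᵀ` = division by `x`), `g_k` = column `k` of
`G₀`, `L(g_k) = Σ_i G₀ i k • Z^i` = multiplication by `g_k`; column `k₀` of `G₀` is the constant
`e_0`; `a + b ≤ N`.  With `𝔄 := span({(Zᵀ)^i g_k : 1 ≤ i ≤ a} ∪ {e_n : n ≥ N - a})` ("`G♯_a`")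
and `𝔅 := span({e_n : n < b} ∪ {Z^i g_k : i < b})` ("`G^{(b)}`"): if any `σ + 1` short syzygies
(`β : Fin p → ℂ^N`, every `β_k` supported in degrees `< a + b`, `Σ_k L(g_k) β_k = 0`) are
linearly dependent, then `finrank (𝔄 ⊓ 𝔅) ≤ σ`. -/
theorem hclR_intersection_le_shortSyzygy : ∀ (N p a b σ : ℕ) (G₀ : Matrix (Fin N) (Fin p) ℂ) (k₀ : Fin p), (∀ n : Fin N, G₀ n k₀ = if (n : ℕ) = 0 then 1 else 0) → a + b ≤ N → (∀ β : Fin (σ + 1) → (Fin p → (Fin N → ℂ)), (∀ (t : Fin (σ + 1)) (k : Fin p) (n : Fin N), a + b ≤ (n : ℕ) → β t k n = 0) → (∀ t : Fin (σ + 1), (∑ k : Fin p, (∑ i : Fin N, G₀ i k • (Matrix.of fun i j : Fin N => if (i : ℕ) = (j : ℕ) + 1 then (1 : ℂ) else 0) ^ (i : ℕ)) *ᵥ β t k) = 0) → ¬ LinearIndependent ℂ β) → Module.finrank ℂ ↥(Submodule.span ℂ ({w : Fin N → ℂ | ∃ (k : Fin p) (i : ℕ), 1 ≤ i ∧ i ≤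 a ∧ w = (Matrix.of fun i j : Fin N => if (i : ℕ) = (j : ℕ) + 1 then (1 : ℂ) else 0)ᵀ ^ i *ᵥ (fun n => G₀ n k)} ∪ {w : Fin N → ℂ | ∃ n : Fin N, N ≤ (n : ℕ) + a ∧ w = Pi.single n 1}) ⊓ Submodule.span ℂ ({w : Fin N → ℂ | ∃ n : Fin N, (n : ℕ) < b ∧ w = Pi.single n 1} ∪ {w : Fin N → ℂ | ∃ (k : Fin p) (i : ℕ), i < b ∧ w = (Matrix.of fun i j : Fin N => if (i : ℕ) = (j : ℕ) + 1 then (1 : ℂ) else 0) ^ i *ᵥ (fun n => G₀ n k)})) ≤ σ := by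
  intro N p a b σ G₀ k₀ hk₀ hab hσ
  have hA := hclR_il_finrank_A_le N p a G₀ k₀ hk₀ (by omega)
  have hB := hclR_il_finrank_B_le N p b G₀ k₀ hk₀
  have hS := hclR_il_finrank_sup N p a b σ G₀ k₀ hk₀ hab hσ
  have h := Submodule.finrank_sup_add_finrank_inf_eq (Submodule.span ℂ ({w : Fin N → ℂ | ∃ (k : Fin p) (i : ℕ), 1 ≤ i ∧ i ≤ a ∧ w = (Matrix.of fun i j : Fin N => if (i : ℕ) = (j : ℕ) + 1 then (1 : ℂ) else 0)ᵀ ^ i *ᵥ (fun n => G₀ n k)} ∪ {w : Fin N → ℂ | ∃ n : Fin N, N ≤ (n : ℕ) + a ∧ w = Pi.single n 1})) (Submodule.span ℂ ({w : Fin N → ℂ | ∃ n : Fin N, (n : ℕ) < b ∧ w = Pi.single n 1} ∪ {w : Fin N → ℂ | ∃ (k : Fin p) (i : ℕ), i < b ∧ w = (Matrix.of fun i j : Fin N => if (i : ℕ) = (j : ℕ) + 1 then (1 : ℂ) else 0) ^ i *ᵥ (fun n => G₀ n k)}))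
  omega

end Summit.MatrixMultiplication.MatrixMultiplication.Theorems
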